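import Mathlib
import Summits.AtomisticToContinuum.Crystallization.Theorems.ChessboardParticlePlanesLjLaminarWindowsSlabCount
import Summits.AtomisticToContinuum.Crystallization.Theorems.ChessboardParticlePlanesLjLaminarWindowsThickCircleB
import HarnessLib

/-! # Thick-circle count — stub `stub_thickCircle` of line `Sketch` (skeleton rev. 14, lead c8), crux
`LjLaminarWindows` (stmt-AtomisticToContinuum-6711)

The number of points of a `7/10`-separated set in the intersection of two spherical shells (outer
radius `L`, thickness `R ≥ 1`, centres at distance `d ∈ [4R, L/2]`, `L ≥ 100 R`) and a ball `B(z, r)`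
is at most `10⁴ (r + √(LR)) R² (L/d + 1)`.  Parts A/B (`…ThickCircleA.lean`, `…ThickCircleB.lean`)
contain the per-cell box count in an adapted orthonormal frame, the axial window, the sector
geometry and the final arithmetic; this file assembles the count by rows × sectors. -/

noncomputable section

open scoped BigOperators InnerProductSpace
open Filter Topology
open Literature.MathematicalPhysics.StatisticalMechanics
open Summit.AtomisticToContinuum.Crystallization.Theorems.ChargedEnergyGapNegative

namespace Summit.AtomisticToContinuum.Crystallization.Theorems.LjLaminarWindowsSketch

/-- **TC — thick-circle count** (stub `stub_thickCircle` of line `Sketch`): the points of a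
`7/10`-separated set lying in the intersection of two spherical shells of outer radius `L` and
thickness `R ≥ 1` with centres at distance `d ∈ [4R, L/2]` (`L ≥ 100R`) and in a ball `B(z, r)`
number at most `10⁴ (r + √(LR)) R² (L/d + 1)`.  Proof: the intersection lies in the shell of `q`
with axial coordinate `t = ⟪y - q, e⟫` in a window of length `W = 2LR/d` (`|t| ≤ 0.27 L`); it is cut
into rows `t ∈ [t_i, t_i + h)` (`h = min √(LR) W`, `< W/h + 1` rows) and azimuthal sectors of
opening `√(R/L)` (`#sectors · √(LR) ≤ 16 (r + √(LR))`, by Jordan's inequality when `r < 0.4L`); each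
cell lies in a box of half-widths `(0.7(h+R), √(LR)/2, 0.75R)` of an adapted orthonormal frame, where
`slabCount_card_le_prod` counts `7/10`-separated points. [folklore] -/
theorem stub_thickCircle :
    ∀ (N : ℕ) (x : Fin N → E3), (∀ j k : Fin N, j ≠ k → (7 : ℝ) / 10 ≤ dist (x j) (x k)) →
      ∀ (L R : ℝ), 1 ≤ R → 100 * R ≤ L →
      ∀ (q q' z : E3) (r : ℝ), 4 * R ≤ dist q q' → dist q q' ≤ L / 2 → 0 ≤ r →
        ((Finset.univ.filter fun j : Fin N =>
            (L - R < dist (x j) q ∧ dist (x j) q ≤ L) ∧ (L - R < dist (x j) q' ∧ dist (x j) q' ≤ L) ∧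
              dist (x j) z ≤ r).card : ℝ) ≤
          10000 * (r + Real.sqrt (L * R)) * R ^ 2 * (L / dist q q' + 1) := by
  intro N x hsep L R hR hL q q' z r hd4 hdL hr
  obtain ⟨hDsq, hD10, hDL⟩ := thickCircle_D hR hL
  set D := Real.sqrt (L * R) with hD
  have hR0 : 0 < R := by linarith
  have hL0 : 0 < L := by linarith
  have hD0 : 0 < D := by linarith
  set d := dist q q' with hd
  have hd0 : 0 < d := by linarith
  set F := Finset.univ.filter fun j : Fin N =>
      (L - R < dist (x j) q ∧ dist (x j) q ≤ L) ∧ (L - R < dist (x j) q' ∧ dist (x j) q' ≤ L) ∧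
        dist (x j) z ≤ r with hF
  have hRHS : 0 ≤ 10000 * (r + D) * R ^ 2 * (L / d + 1) := by positivity
  rcases F.eq_empty_or_nonempty with h0 | ⟨p₀, hp₀⟩
  · rw [h0, Finset.card_empty, Nat.cast_zero]
    exact hRHS
  have hmem : ∀ p ∈ F, (L - R < dist (x p) q ∧ dist (x p) q ≤ L) ∧
      (L - R < dist (x p) q' ∧ dist (x p) q' ≤ L) ∧ dist (x p) z ≤ r := by
    intro p hp
    rw [hF, Finset.mem_filter] at hp
    exact hp.2
  -- the axis `e` and the axial coordinate of the points
  set e : E3 := (1 / d) • (q' - q) with he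
  have he1 : ‖e‖ = 1 := by
    have h1 : ‖q' - q‖ = d := by rw [hd, dist_comm, dist_eq_norm]
    rw [he, norm_smul, h1, norm_div, norm_one, Real.norm_eq_abs, abs_of_pos hd0]
    field_simp
  have hpt : ∀ p ∈ F, L - R < ‖x p - q‖ ∧ ‖x p - q‖ ≤ L ∧ |⟪x p - q, e⟫_ℝ| ≤ 27 / 100 * L ∧
      d / 2 - L * R / d < ⟪x p - q, e⟫_ℝ ∧ ⟪x p - q, e⟫_ℝ < d / 2 - L * R / d + 2 * L * R / d := by
    intro p hp
    obtain ⟨⟨ha1, ha2⟩, ⟨hb1, hb2⟩, -⟩ := hmem p hp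
    have ht := thickCircle_tcoord q q' (x p) hd0
    obtain ⟨h1, h2, h3⟩ := thickCircle_tbounds hR hL hd4 hdL ha1 ha2 hb1 hb2 ht
    rw [← dist_eq_norm]
    exact ⟨ha1, ha2, h3, h1, h2⟩
  -- the adapted Parseval frame `(e, n, g)`
  obtain ⟨ha1₀, ha2₀, ht₀, -, -⟩ := hpt p₀ hp₀
  obtain ⟨n, g, hP, hg0, hn0⟩ := thickCircle_frame hR hL e (x p₀ - q) he1 ha1₀ ha2₀ ht₀
  -- rows
  set W := 2 * L * R / d with hWdef
  set h := min D W with hhdef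
  have hW0 : 0 < W := by positivity
  have hh0 : 0 < h := lt_min hD0 hW0
  have hhD : h ≤ D := min_le_left _ _
  set tlo := d / 2 - L * R / d with htlo
  set K := ⌈W / h⌉₊ with hKdef
  have hK : (K : ℝ) < W / h + 1 := Nat.ceil_lt_add_one (by positivity)
  -- sectors
  set α := D / L with hα
  obtain ⟨Ks, hKs, hKsmem⟩ := thickCircle_sectorCount hR hL hr
  -- the cell index map
  set ρf : Fin N → ℕ := fun p => ⌊(⟪x p - q, e⟫_ℝ - tlo) / h⌋₊ with hρf
  set kf : Fin N → ℕ := fun p =>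
    ⌊(Complex.arg ⟨⟪x p - q, n⟫_ℝ, ⟪x p - q, g⟫_ℝ⟩ + Real.pi) / α⌋₊ with hkf
  have hmaps : ∀ p ∈ F, (ρf p, kf p) ∈ Finset.range K ×ˢ Ks := by
    intro p hp
    obtain ⟨ha1, ha2, ht, ht1, ht2⟩ := hpt p hp
    rw [Finset.mem_product, Finset.mem_range]
    constructor
    · show ⌊(⟪x p - q, e⟫_ℝ - tlo) / h⌋₊ < K
      rw [Nat.floor_lt (div_nonneg (by linarith) hh0.le)]
      calc (⟪x p - q, e⟫_ℝ - tlo) / h < W / h := div_lt_div_of_pos_right (by linarith) hh0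
        _ ≤ K := Nat.le_ceil _
    · apply hKsmem
      · exact Complex.neg_pi_lt_arg _
      · exact Complex.arg_le_pi _
      · intro hr4
        have hww : ‖(x p - q) - (x p₀ - q)‖ ≤ 2 * r := by
          have e1 : (x p - q) - (x p₀ - q) = x p - x p₀ := by abel
          rw [e1, ← dist_eq_norm]
          calc dist (x p) (x p₀) ≤ dist (x p) z + dist (x p₀) z := dist_triangle_right _ _ _
            _ ≤ r + r := add_le_add (hmem p hp).2.2 (hmem p₀ hp₀).2.2
            _ = 2 * r := by ring
        exact thickCircle_smallr e n g hP hR hL hr4 (x p - q) (x p₀ - q) ha1 ha2 ht hg0 hn0 hww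
  -- the per-cell bound
  have hcellb : ∀ c ∈ Finset.range K ×ˢ Ks,
      ((F.filter fun p => (ρf p, kf p) = c).card : ℝ) ≤
        (7 / 2 * h + 7 / 2 * R + 1) * (5 / 2 * D + 1) * (15 / 4 * R + 1) := by
    rintro ⟨i, k⟩ -
    set φk := -Real.pi + ((k : ℝ) + 1 / 2) * α with hφk
    refine thickCircle_cell x hsep hR hL hh0 hhD q e (Real.cos φk • n + Real.sin φk • g)
      (-Real.sin φk • n + Real.cos φk • g) (thickCircle_parseval_rotate e n g hP φk) _
      (tl := tlo + (i : ℝ) * h) ?_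
    intro p hp
    rw [Finset.mem_filter] at hp
    obtain ⟨hpF, hpc⟩ := hp
    simp only [Prod.mk.injEq] at hpc
    obtain ⟨hi, hk⟩ := hpc
    obtain ⟨ha1, ha2, ht, ht1, ht2⟩ := hpt p hpF
    obtain ⟨hs, hσ⟩ := thickCircle_sector e n g hP hR hL (x p - q) ha1 ha2 ht k hk.symm
    refine ⟨ha1, ha2, ht, ?_, ?_, hs, hσ⟩
    · have h1 : (i : ℝ) ≤ (⟪x p - q, e⟫_ℝ - tlo) / h := by
        rw [← hi]
        exact Nat.floor_le (div_nonneg (by linarith) hh0.le)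
      rw [le_div_iff₀ hh0] at h1
      linarith
    · have h2 : (⟪x p - q, e⟫_ℝ - tlo) / h < i + 1 := by
        rw [← hi]
        exact Nat.lt_floor_add_one _
      rw [div_lt_iff₀ hh0] at h2
      linarith
  -- summing over the cells
  have hcard : F.card = ∑ c ∈ Finset.range K ×ˢ Ks, (F.filter fun p => (ρf p, kf p) = c).card :=
    Finset.card_eq_sum_card_fiberwise fun p hp => hmaps p hp
  calc (F.card : ℝ)
      = ∑ c ∈ Finset.range K ×ˢ Ks, ((F.filter fun p => (ρf p, kf p) = c).card : ℝ) := by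
        rw [hcard]
        push_cast
        rfl
    _ ≤ ∑ _c ∈ Finset.range K ×ˢ Ks,
          (7 / 2 * h + 7 / 2 * R + 1) * (5 / 2 * D + 1) * (15 / 4 * R + 1) :=
        Finset.sum_le_sum hcellb
    _ = (K : ℝ) * Ks.card * ((7 / 2 * h + 7 / 2 * R + 1) * (5 / 2 * D + 1) * (15 / 4 * R + 1)) := by
        rw [Finset.sum_const, Finset.card_product, Finset.card_range, nsmul_eq_mul]
        push_cast
        ring
    _ ≤ 10000 * (r + D) * R ^ 2 * (L / d + 1) :=
        thickCircle_final hR hL hDsq hD10 hd4 hr rfl rfl hK (Nat.cast_nonneg _) hKs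

end Summit.AtomisticToContinuum.Crystallization.Theorems.LjLaminarWindowsSketch

end
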